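import Summits.QuantumFields.QCD.Theses.QuarksAsStableAction
import Literature.MathematicalPhysics.QuantumLattice.WilsonDiracAP

/-!
# Invertibility of the spin-blind Wilson slice operator `B_t = (m+4)·1 − ½Σ_j (H_j + H_j⁻)`
(helper for crux stmt-QuantumFields-9737, line `Sketch` — F3-core STEP β, stub
`isUnit_det_sliceMassHop`)

The spin-blind slice operator `B_t = (m+4)·1 − ½Σ_j (H_j + H_j⁻)` of the `r = 1` Wilson fermion
matrix on the spatial slice `t` of the four-torus `(ℤ/L)⁴` (Lüscher's `B`, Smit's `A(U)`; `H_j` the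
gauged forward hop in the spatial direction `j`, a permutation-times-unitary matrix on
`(ℤ/L)³ × colour`, `H_j⁻ = H_j†` the backward hop) is invertible for every bare mass `m > −1`
(hopping parameter `κ < 1/6`), every gauge field, every unitary representation `ρ` and every `L ≥ 1`.
Proof: each `H_j` is an `ℓ²`-isometry (`H_j H_j† = 1`: a unitary colour rotation of the block of the
vector at the shifted site, and `y ↦ y + ê_j` is a bijection of `(ℤ/L)³`, also for `L = 1, 2`), so
`B_t x = 0` gives `2(m+4)‖x‖ = ‖Σ_j (H_j x + H_j† x)‖ ≤ 6‖x‖ < 2(m+4)‖x‖`, whence `x = 0`; the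
argument is the one of `det_thermalDiracCore_ne_zero` (tree, thermal operator), run with `Σ |·|²`
instead of norms. [cite: Luscher1977, pp. 283–292]; [cite: MontvayMunster1994, §4.2.3 (4.111)].
Pure theorem file (no definitions): the hop matrices are written as literals.
-/

noncomputable section

namespace Summit.QuantumFields.QCD.Cruxes.StableActionBridge.Sketch

open Literature.MathematicalPhysics.QuantumLattice Literature.MathematicalPhysics.QuantumFieldTheory
open Literature.Probability.LatticeModels (TorusSite)

namespace SliceMassHop

open Matrix

/-! ### Abstract `ℓ²` facts -/

/-- `Σ_v |x_v|²` as the self-pairing `x̄ · x`. -/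
theorem star_dotProduct_self_eq_sum {n : Type*} [Fintype n] (x : n → ℂ) :
    star x ⬝ᵥ x = ((∑ v, ‖x v‖ ^ 2 : ℝ) : ℂ) := by
  simp only [dotProduct, Pi.star_apply, Complex.star_def, Complex.conj_mul', Complex.ofReal_sum,
    Complex.ofReal_pow]

/-- An `ℓ²`-isometry: `H† H = 1` gives `Σ_v |(H x)_v|² = Σ_v |x_v|²`. -/
theorem sum_normSq_mulVec_of_conjTranspose_mul_self {n : Type*} [Fintype n] [DecidableEq n]
    (H : Matrix n n ℂ) (hH : Hᴴ * H = 1) (x : n → ℂ) :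
    ∑ v, ‖(H *ᵥ x) v‖ ^ 2 = ∑ v, ‖x v‖ ^ 2 := by
  have h : star (H *ᵥ x) ⬝ᵥ (H *ᵥ x) = star x ⬝ᵥ x := by
    rw [star_mulVec, dotProduct_mulVec, vecMul_vecMul, hH, vecMul_one]
  rw [star_dotProduct_self_eq_sum, star_dotProduct_self_eq_sum] at h
  exact_mod_cast h

/-- **Kernel-freeness by norm comparison**: if `c • x = Σ_i f_i` with every `f_i` of `ℓ²`-norm at
most that of `x` and fewer than `c` summands, then `x = 0`
(`c²‖x‖² = ‖Σ_i f_i‖² ≤ k Σ_i ‖f_i‖² ≤ k²‖x‖²`, `k < c`). -/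
theorem eq_zero_of_smul_eq_sum {n ι : Type*} [Fintype n] [Fintype ι] (x : n → ℂ) (f : ι → n → ℂ)
    (hf : ∀ i, ∑ v, ‖f i v‖ ^ 2 ≤ ∑ v, ‖x v‖ ^ 2) {c : ℝ} (hc : (Fintype.card ι : ℝ) < c)
    (hx : (c : ℂ) • x = ∑ i, f i) : x = 0 := by
  have hX0 : 0 ≤ ∑ v, ‖x v‖ ^ 2 := Finset.sum_nonneg fun v _ => sq_nonneg _
  -- `‖c x‖² = c² X`
  have hL : ∑ v, ‖((c : ℂ) • x) v‖ ^ 2 = c ^ 2 * ∑ v, ‖x v‖ ^ 2 := by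
    rw [Finset.mul_sum]
    refine Finset.sum_congr rfl fun v _ => ?_
    rw [Pi.smul_apply, smul_eq_mul, norm_mul, mul_pow, Complex.norm_real, Real.norm_eq_abs, sq_abs]
  -- `‖Σ_i f_i‖² ≤ k Σ_i ‖f_i‖² ≤ k² X`
  have hsum : ∀ v, ‖(∑ i, f i) v‖ ^ 2 ≤ (Fintype.card ι : ℝ) * ∑ i, ‖f i v‖ ^ 2 := fun v => by
    rw [Finset.sum_apply]
    calc ‖∑ i, f i v‖ ^ 2
        ≤ (∑ i, ‖f i v‖) ^ 2 := by
          gcongr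
          exact norm_sum_le _ _
      _ ≤ (Finset.univ : Finset ι).card * ∑ i, ‖f i v‖ ^ 2 := sq_sum_le_card_mul_sum_sq
      _ = (Fintype.card ι : ℝ) * ∑ i, ‖f i v‖ ^ 2 := by rw [Finset.card_univ]
  have hR : ∑ v, ‖(∑ i, f i) v‖ ^ 2 ≤ (Fintype.card ι : ℝ) ^ 2 * ∑ v, ‖x v‖ ^ 2 := by
    calc ∑ v, ‖(∑ i, f i) v‖ ^ 2
        ≤ ∑ v, ((Fintype.card ι : ℝ) * ∑ i, ‖f i v‖ ^ 2) := Finset.sum_le_sum fun v _ => hsum v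
      _ = (Fintype.card ι : ℝ) * ∑ i, ∑ v, ‖f i v‖ ^ 2 := by
          rw [← Finset.mul_sum, Finset.sum_comm]
      _ ≤ (Fintype.card ι : ℝ) * ∑ _i : ι, ∑ v, ‖x v‖ ^ 2 :=
          mul_le_mul_of_nonneg_left (Finset.sum_le_sum fun i _ => hf i) (Nat.cast_nonneg _)
      _ = (Fintype.card ι : ℝ) ^ 2 * ∑ v, ‖x v‖ ^ 2 := by
          rw [Finset.sum_const, Finset.card_univ, nsmul_eq_mul]
          ring
  have hle : c ^ 2 * ∑ v, ‖x v‖ ^ 2 ≤ (Fintype.card ι : ℝ) ^ 2 * ∑ v, ‖x v‖ ^ 2 := by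
    rw [← hL, hx]
    exact hR
  have hk0 : (0 : ℝ) ≤ Fintype.card ι := Nat.cast_nonneg _
  have hc2 : (Fintype.card ι : ℝ) ^ 2 < c ^ 2 := by nlinarith
  have hX : ∑ v, ‖x v‖ ^ 2 = 0 := by nlinarith
  funext v
  have hv := (Finset.sum_eq_zero_iff_of_nonneg fun v _ => sq_nonneg ‖x v‖).1 hX v (Finset.mem_univ _)
  exact norm_eq_zero.1 (pow_eq_zero_iff two_ne_zero |>.1 hv)

/-- **A block permutation-times-unitary matrix is a co-isometry**: for an injective relabelling `s`
of the sites and unitary colour blocks `V_y` (`V_y V_y† = 1`), the hop matrix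
`H (y,a) (z,b) = [z = s y] (V_y)_{ab}` satisfies `H H† = 1`. -/
theorem blockPermHop_mul_conjTranspose {ι κ : Type*} [Fintype ι] [DecidableEq ι] [Fintype κ]
    [DecidableEq κ] (s : ι → ι) (hs : Function.Injective s) (V : ι → Matrix κ κ ℂ)
    (hV : ∀ y, V y * (V y)ᴴ = 1) :
    (Matrix.of fun a b : ι × κ => if b.1 = s a.1 then V a.1 a.2 b.2 else 0) *
        (Matrix.of fun a b : ι × κ => if b.1 = s a.1 then V a.1 a.2 b.2 else 0)ᴴ = 1 := by
  ext ⟨y, a⟩ ⟨z, c⟩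
  rw [mul_apply, Fintype.sum_prod_type, one_apply,
    Finset.sum_eq_single_of_mem (s y) (Finset.mem_univ _)]
  · simp only [of_apply, conjTranspose_apply, if_true, Prod.mk.injEq]
    by_cases hyz : y = z
    · subst hyz
      simp only [if_true, true_and]
      have h2 := congrFun (congrFun (hV y) a) c
      rw [mul_apply, one_apply] at h2
      rw [← h2]
      refine Finset.sum_congr rfl fun b _ => ?_
      rw [conjTranspose_apply]
    · have hne : s y ≠ s z := fun h => hyz (hs h)
      simp [hne, hyz]
  · intro w _ hw
    simp [of_apply, hw]

/-- … hence also an isometry: `H† H = 1`. -/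
theorem conjTranspose_mul_blockPermHop {ι κ : Type*} [Fintype ι] [DecidableEq ι] [Fintype κ]
    [DecidableEq κ] (s : ι → ι) (hs : Function.Injective s) (V : ι → Matrix κ κ ℂ)
    (hV : ∀ y, V y * (V y)ᴴ = 1) :
    (Matrix.of fun a b : ι × κ => if b.1 = s a.1 then V a.1 a.2 b.2 else 0)ᴴ *
        (Matrix.of fun a b : ι × κ => if b.1 = s a.1 then V a.1 a.2 b.2 else 0) = 1 :=
  mul_eq_one_comm.1 (blockPermHop_mul_conjTranspose s hs V hV)

/-! ### The gauged hops of the slice operator -/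

variable {Nc L : ℕ} {G : Type*} [Group G] (ρ : G →* Matrix (Fin Nc) (Fin Nc) ℂ)

/-- A unitary representation matrix is a co-isometry: `ρ(g) ρ(g)† = 1`. -/
theorem rep_mul_conjTranspose (hρ : ∀ g, ρ g ∈ Matrix.unitaryGroup (Fin Nc) ℂ) (g : G) :
    ρ g * (ρ g)ᴴ = 1 := by
  rw [← star_eq_conjTranspose]
  exact Matrix.mem_unitaryGroup_iff.1 (hρ g)

/-- For a unitary representation the inverse link is the adjoint: `ρ(g⁻¹) = ρ(g)†`. -/
theorem rep_inv_eq_conjTranspose (hρ : ∀ g, ρ g ∈ Matrix.unitaryGroup (Fin Nc) ℂ) (g : G) :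
    ρ g⁻¹ = (ρ g)ᴴ := by
  have h1 : ρ g⁻¹ * ρ g = 1 := by rw [← map_mul, inv_mul_cancel, map_one]
  calc ρ g⁻¹ = ρ g⁻¹ * (ρ g * (ρ g)ᴴ) := by rw [rep_mul_conjTranspose ρ hρ, mul_one]
    _ = (ρ g)ᴴ := by rw [← mul_assoc, h1, one_mul]

omit [Group G] in
/-- The spatial shift `y ↦ y + ê_j` of the slice `(ℤ/L)³` is injective (a bijection; also for
`L = 1, 2`). -/
theorem site_shift_injective (j : Fin 3) :
    Function.Injective fun y : TorusSite 3 L => Site.shift y j :=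
  fun _ _ h => add_right_cancel h

variable [NeZero L]

/-- **The forward hop is an isometry**: `H_j† H_j = 1` for the gauged forward hop
`H_j (y,a) (z,b) = [z = y + ê_j] ρ(U_{(t,y), j})_{ab}` on the slice `t`. -/
theorem conjTranspose_mul_hop (hρ : ∀ g, ρ g ∈ Matrix.unitaryGroup (Fin Nc) ℂ)
    (U : GaugeConfig 4 L G) (t : ZMod L) (j : Fin 3) :
    (Matrix.of fun a b : TorusSite 3 L × Fin Nc =>
        if b.1 = Site.shift a.1 j then ρ (U ((Fin.cons t a.1 : TorusSite 4 L), j.succ)) a.2 b.2 else 0)ᴴ *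
      (Matrix.of fun a b : TorusSite 3 L × Fin Nc =>
        if b.1 = Site.shift a.1 j then ρ (U ((Fin.cons t a.1 : TorusSite 4 L), j.succ)) a.2 b.2 else 0) =
      1 :=
  conjTranspose_mul_blockPermHop (fun y : TorusSite 3 L => Site.shift y j) (site_shift_injective j)
    (fun y : TorusSite 3 L => ρ (U ((Fin.cons t y : TorusSite 4 L), j.succ)))
    fun _ => rep_mul_conjTranspose ρ hρ _

/-- **The forward hop is a co-isometry**: `H_j H_j† = 1`. -/
theorem hop_mul_conjTranspose (hρ : ∀ g, ρ g ∈ Matrix.unitaryGroup (Fin Nc) ℂ)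
    (U : GaugeConfig 4 L G) (t : ZMod L) (j : Fin 3) :
    (Matrix.of fun a b : TorusSite 3 L × Fin Nc =>
        if b.1 = Site.shift a.1 j then ρ (U ((Fin.cons t a.1 : TorusSite 4 L), j.succ)) a.2 b.2 else 0) *
      (Matrix.of fun a b : TorusSite 3 L × Fin Nc =>
        if b.1 = Site.shift a.1 j then ρ (U ((Fin.cons t a.1 : TorusSite 4 L), j.succ)) a.2 b.2 else 0)ᴴ =
      1 :=
  blockPermHop_mul_conjTranspose (fun y : TorusSite 3 L => Site.shift y j) (site_shift_injective j)
    (fun y : TorusSite 3 L => ρ (U ((Fin.cons t y : TorusSite 4 L), j.succ)))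
    fun _ => rep_mul_conjTranspose ρ hρ _

omit [NeZero L] in
/-- **The backward hop is the adjoint of the forward hop**: `H_j⁻ = H_j†` (inverse link = adjoint
link for a unitary representation). -/
theorem hopBack_eq_conjTranspose (hρ : ∀ g, ρ g ∈ Matrix.unitaryGroup (Fin Nc) ℂ)
    (U : GaugeConfig 4 L G) (t : ZMod L) (j : Fin 3) :
    (Matrix.of fun a b : TorusSite 3 L × Fin Nc =>
        if a.1 = Site.shift b.1 j then ρ (U ((Fin.cons t b.1 : TorusSite 4 L), j.succ))⁻¹ a.2 b.2 else 0) =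
      (Matrix.of fun a b : TorusSite 3 L × Fin Nc =>
        if b.1 = Site.shift a.1 j then ρ (U ((Fin.cons t a.1 : TorusSite 4 L), j.succ)) a.2 b.2 else 0)ᴴ := by
  ext a b
  simp only [conjTranspose_apply, of_apply]
  split_ifs with h
  · rw [rep_inv_eq_conjTranspose ρ hρ, conjTranspose_apply]
  · rw [star_zero]

omit [NeZero L] in
/-- **The slice operator in matrix form**: the literal `B_t` equals
`(m+4)·1 − ½ Σ_j (H_j + H_j⁻)`. -/
theorem sliceOp_eq (U : GaugeConfig 4 L G) (m : ℝ) (t : ZMod L) :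
    (Matrix.of fun a b : TorusSite 3 L × Fin Nc =>
        (if a = b then ((m + 4 : ℝ) : ℂ) else 0) -
          (1 / 2 : ℂ) * ∑ j : Fin 3,
            ((if b.1 = Site.shift a.1 j then ρ (U ((Fin.cons t a.1 : TorusSite 4 L), j.succ)) a.2 b.2 else 0) +
              (if a.1 = Site.shift b.1 j then
                ρ (U ((Fin.cons t b.1 : TorusSite 4 L), j.succ))⁻¹ a.2 b.2 else 0))) =
      ((m + 4 : ℝ) : ℂ) • (1 : Matrix (TorusSite 3 L × Fin Nc) (TorusSite 3 L × Fin Nc) ℂ) -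
        (1 / 2 : ℂ) • ∑ j : Fin 3,
          ((Matrix.of fun a b : TorusSite 3 L × Fin Nc =>
              if b.1 = Site.shift a.1 j then ρ (U ((Fin.cons t a.1 : TorusSite 4 L), j.succ)) a.2 b.2 else 0) +
            (Matrix.of fun a b : TorusSite 3 L × Fin Nc =>
              if a.1 = Site.shift b.1 j then
                ρ (U ((Fin.cons t b.1 : TorusSite 4 L), j.succ))⁻¹ a.2 b.2 else 0)) := by
  ext a b
  simp only [of_apply, Matrix.sub_apply, Matrix.smul_apply, Matrix.one_apply, Matrix.sum_apply,
    Matrix.add_apply, smul_eq_mul, mul_ite, mul_one, mul_zero]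

/-- **Kernel-freeness of a mass-plus-hopping operator**: for isometries `H_j` (`H_j† H_j = 1 = H_j H_j†`)
indexed by fewer than `c` directions, `((c·1 − ½ Σ_j (H_j + H_j†)) x = 0 → x = 0`. -/
theorem eq_zero_of_massHop_mulVec_eq_zero {n ι : Type*} [Fintype n] [DecidableEq n] [Fintype ι]
    (H : ι → Matrix n n ℂ) (hiso : ∀ j, (H j)ᴴ * H j = 1) (hco : ∀ j, H j * (H j)ᴴ = 1)
    {c : ℝ} (hc : (Fintype.card ι : ℝ) < c) {x : n → ℂ}
    (hx : (((c : ℝ) : ℂ) • (1 : Matrix n n ℂ) - (1 / 2 : ℂ) • ∑ j, (H j + (H j)ᴴ)) *ᵥ x = 0) :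
    x = 0 := by
  rw [sub_mulVec, smul_mulVec, one_mulVec, smul_mulVec, sum_mulVec, sub_eq_zero] at hx
  simp_rw [add_mulVec] at hx
  -- `2c x = Σ_{i : ι ⊕ ι} f_i` with `f = (H_j x)_j ⊔ (H_j† x)_j`
  have hx2 : ((2 * c : ℝ) : ℂ) • x =
      ∑ i : ι ⊕ ι, Sum.elim (fun j => H j *ᵥ x) (fun j => (H j)ᴴ *ᵥ x) i := by
    rw [Fintype.sum_sum_type]
    simp only [Sum.elim_inl, Sum.elim_inr]
    rw [← Finset.sum_add_distrib, Complex.ofReal_mul, Complex.ofReal_ofNat, ← smul_smul, hx,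
      smul_smul]
    norm_num
  refine eq_zero_of_smul_eq_sum x _ (fun i => ?_) ?_ hx2
  · rcases i with j | j
    · exact (sum_normSq_mulVec_of_conjTranspose_mul_self (H j) (hiso j) x).le
    · refine (sum_normSq_mulVec_of_conjTranspose_mul_self (H j)ᴴ ?_ x).le
      rw [conjTranspose_conjTranspose]
      exact hco j
  · simp only [Fintype.card_sum]
    push_cast
    linarith

/-- **Kernel-freeness of the slice operator** for `m > −1`: `B_t x = 0 → x = 0`. -/
theorem eq_zero_of_sliceOp_mulVec_eq_zero (hρ : ∀ g, ρ g ∈ Matrix.unitaryGroup (Fin Nc) ℂ)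
    (U : GaugeConfig 4 L G) {m : ℝ} (hm : -1 < m) (t : ZMod L) {x : TorusSite 3 L × Fin Nc → ℂ}
    (hx : (Matrix.of fun a b : TorusSite 3 L × Fin Nc =>
        (if a = b then ((m + 4 : ℝ) : ℂ) else 0) -
          (1 / 2 : ℂ) * ∑ j : Fin 3,
            ((if b.1 = Site.shift a.1 j then ρ (U ((Fin.cons t a.1 : TorusSite 4 L), j.succ)) a.2 b.2 else 0) +
              (if a.1 = Site.shift b.1 j then
                ρ (U ((Fin.cons t b.1 : TorusSite 4 L), j.succ))⁻¹ a.2 b.2 else 0))) *ᵥ x = 0) :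
    x = 0 := by
  rw [sliceOp_eq ρ U m t] at hx
  simp_rw [hopBack_eq_conjTranspose ρ hρ U t] at hx
  exact eq_zero_of_massHop_mulVec_eq_zero
    (fun j : Fin 3 => Matrix.of fun a b : TorusSite 3 L × Fin Nc =>
      if b.1 = Site.shift a.1 j then ρ (U ((Fin.cons t a.1 : TorusSite 4 L), j.succ)) a.2 b.2 else 0)
    (fun j => conjTranspose_mul_hop ρ hρ U t j) (fun j => hop_mul_conjTranspose ρ hρ U t j)
    (by simp only [Fintype.card_fin]; push_cast; linarith) hx

end SliceMassHop

/-- **Invertibility of the spin-blind Wilson slice operator** (stub `isUnit_det_sliceMassHop` of line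
`Sketch`, F3-core STEP β): for a unitary representation `ρ`, every gauge field `U` on `(ℤ/L)⁴`
(`L ≥ 1`), every bare mass `m > −1` and every time slice `t`, the operator
`B_t = (m+4)·1 − ½Σ_j (H_j + H_j⁻)` on `(ℤ/L)³ × colour` has `det B_t ≠ 0`.
[cite: Luscher1977, pp. 283–292]; [cite: MontvayMunster1994, §4.2.3 (4.111)]. -/
theorem isUnit_det_sliceMassHop :
    ∀ (Nc L : ℕ) [NeZero L] (G : Type) [Group G] (ρ : G →* Matrix (Fin Nc) (Fin Nc) ℂ),
      (∀ g, ρ g ∈ Matrix.unitaryGroup (Fin Nc) ℂ) → ∀ (U : GaugeConfig 4 L G) (m : ℝ), -1 < m → ∀ t : ZMod L,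
        IsUnit (Matrix.of fun a b : TorusSite 3 L × Fin Nc =>
          (if a = b then ((m + 4 : ℝ) : ℂ) else 0) -
            (1 / 2 : ℂ) * ∑ j : Fin 3,
              ((if b.1 = Literature.MathematicalPhysics.QuantumFieldTheory.Site.shift a.1 j then
                  ρ (U ((Fin.cons t a.1 : TorusSite 4 L), j.succ)) a.2 b.2 else 0) +
                (if a.1 = Literature.MathematicalPhysics.QuantumFieldTheory.Site.shift b.1 j then
                  ρ (U ((Fin.cons t b.1 : TorusSite 4 L), j.succ))⁻¹ a.2 b.2 else 0))).det := by
  intro Nc L _ G _ ρ hρ U m hm t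
  refine isUnit_iff_ne_zero.2 fun hdet => ?_
  obtain ⟨x, hx0, hx⟩ := Matrix.exists_mulVec_eq_zero_iff.2 hdet
  exact hx0 (SliceMassHop.eq_zero_of_sliceOp_mulVec_eq_zero ρ hρ U hm t hx)

end Summit.QuantumFields.QCD.Cruxes.StableActionBridge.Sketch

end
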